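import Mathlib
import Summits.Ventures.PercRepro.TriangleCapOneTriangleD

/-!
# PercRepro — the two-triangle case of the dense-corner stability below `k = 10`, part A: the refined
triangle deficit, the deficit split, and the counting lemmas (p3, gen 35; part 35a)

The dense-corner stability (`Σ_v d(v)² + (k − 2) ≤ m·k` off the complete bipartite spanning graphs) of gen 34
holds for `k ≥ 10` because two triangles cost `2(k − 6) ≥ k − 2`.  Below `10` the two-triangle case needs the
slack that the envelope throws away:

* `deficit_triangle_outer` — the three deficits of a triangle sum to at least `(k − 3) + 2·|outer|`
  (an outer vertex lies in all three deficit sets, every other vertex in at least one);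
* `card_mul_add_two_mul_sum_outer_le` — summed over the ordered triangles by the rotation:
  `k·|T₃| + 2·Σ_{T₃} |outer| ≤ 3·Σ_{T₃} deficit + 3·|T₃|`;
* `sum_deficit_split` — `Σ deficit = Σ_{T₃} deficit + Σ_{codeg = 0} deficit` (`codeg ≤ 1`);
* `six_le_sum_outer` — a triangle with an outer vertex contributes `6` to `Σ_{T₃} |outer|`;
* `eighteen_le_card_triangles3` — three triangles, the second with a vertex off the first and the third with
  a vertex off both, give `18` ordered triangles;
* **`stability_of_triangle_bounds`** — for `k ≥ 8` and `|T₃| ≥ 12`, any of `|T₃| ≥ 18`, `Σ_{T₃} |outer| ≥ 6`,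
  `Σ_{codeg = 0} deficit ≥ 4` gives `Σ_v d(v)² + (k − 2) ≤ m·k`.

Axioms: standard.
-/

namespace PercRepro

namespace TriangleCap

namespace C047

open Finset

variable {V : Type*} [Fintype V] [DecidableEq V]

omit [DecidableEq V] in
/-- The deficit is symmetric. -/
theorem deficit_comm (D : SimpleGraph V) [DecidableRel D.Adj] (x y : V) :
    deficit D (y, x) = deficit D (x, y) := by
  unfold deficit
  congr 1
  ext z
  simp only [mem_filter, mem_univ, true_and]
  exact and_comm

omit [DecidableEq V] in
/-- The codegree is symmetric. -/
theorem codeg_comm (D : SimpleGraph V) [DecidableRel D.Adj] (x y : V) :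
    codeg D (y, x) = codeg D (x, y) := by
  unfold codeg
  congr 1
  ext z
  simp only [mem_filter, mem_univ, true_and]
  exact and_comm

omit [DecidableEq V] in
/-- A vertex adjacent to neither end makes the deficit positive. -/
theorem one_le_deficit (D : SimpleGraph V) [DecidableRel D.Adj] {x y z : V} (hx : ¬ D.Adj x z)
    (hy : ¬ D.Adj y z) : 1 ≤ deficit D (x, y) := by
  unfold deficit
  apply card_pos.mpr
  exact ⟨z, by simp only [mem_filter, mem_univ, true_and]; exact ⟨hx, hy⟩⟩

/-- **THE REFINED TRIANGLE DEFICIT:** `k + 2·|outer| ≤ deficit (u, v) + deficit (v, w) + deficit (w, u) + 3`. -/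
theorem deficit_triangle_outer (D : SimpleGraph V) [DecidableRel D.Adj] (hK : K4mFree D) {u v w : V}
    (huv : D.Adj u v) (huw : D.Adj u w) (hvw : D.Adj v w) :
    Fintype.card V + 2 * (outer D u v w).card ≤
      deficit D (u, v) + deficit D (v, w) + deficit D (w, u) + 3 := by
  have key : ∀ x : V, 1 + 2 * (if x ∈ outer D u v w then 1 else 0) ≤
      (if ¬ D.Adj u x ∧ ¬ D.Adj v x then 1 else 0) + (if ¬ D.Adj v x ∧ ¬ D.Adj w x then 1 else 0) +
      (if ¬ D.Adj w x ∧ ¬ D.Adj u x then 1 else 0) +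
      ((if x = u then 1 else 0) + (if x = v then 1 else 0) + (if x = w then 1 else 0)) := by
    intro x
    by_cases hxu : x = u
    · subst hxu
      have h : x ∉ outer D x v w := by rw [mem_outer]; exact fun h => h.2.1 huv.symm
      have h1 : (if x ∈ outer D x v w then 1 else 0) = 0 := if_neg h
      have h2 : (if x = x then 1 else 0) = 1 := if_pos rfl
      omega
    by_cases hxv : x = v
    · subst hxv
      have h : x ∉ outer D u x w := by rw [mem_outer]; exact fun h => h.1 huv
      have h1 : (if x ∈ outer D u x w then 1 else 0) = 0 := if_neg h
      have h2 : (if x = x then 1 else 0) = 1 := if_pos rfl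
      omega
    by_cases hxw : x = w
    · subst hxw
      have h : x ∉ outer D u v x := by rw [mem_outer]; exact fun h => h.1 huw
      have h1 : (if x ∈ outer D u v x then 1 else 0) = 0 := if_neg h
      have h2 : (if x = x then 1 else 0) = 1 := if_pos rfl
      omega
    have ho : x ∈ outer D u v w ↔ (¬ D.Adj u x ∧ ¬ D.Adj v x ∧ ¬ D.Adj w x) := mem_outer D u v w x
    by_cases hu : D.Adj u x <;> by_cases hv : D.Adj v x <;> by_cases hw : D.Adj w x
    · exact (not_adj_both D hK huv huw hvw (Ne.symm hxw) hu hv).elim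
    · exact (not_adj_both D hK huv huw hvw (Ne.symm hxw) hu hv).elim
    · exact (not_adj_both D hK huw huv hvw.symm (Ne.symm hxv) hu hw).elim
    · simp [hu, hv, hw, hxu, hxv, hxw, ho]
    · exact (not_adj_both D hK hvw huv.symm huw.symm (Ne.symm hxu) hv hw).elim
    · simp [hu, hv, hw, hxu, hxv, hxw, ho]
    · simp [hu, hv, hw, hxu, hxv, hxw, ho]
    · simp [hu, hv, hw, hxu, hxv, hxw, ho]
  have hsum := sum_le_sum (fun x (_ : x ∈ univ) => key x)
  simp only [sum_add_distrib, sum_ite_eq', mem_univ, if_true, sum_const, card_univ, smul_eq_mul,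
    mul_one, ← mul_sum, sum_ite_mem, univ_inter] at hsum
  have e1 : deficit D (u, v) = ∑ x, if ¬ D.Adj u x ∧ ¬ D.Adj v x then 1 else 0 := by
    unfold deficit; rw [card_filter]
  have e2 : deficit D (v, w) = ∑ x, if ¬ D.Adj v x ∧ ¬ D.Adj w x then 1 else 0 := by
    unfold deficit; rw [card_filter]
  have e3 : deficit D (w, u) = ∑ x, if ¬ D.Adj w x ∧ ¬ D.Adj u x then 1 else 0 := by
    unfold deficit; rw [card_filter]
  rw [e1, e2, e3]
  omega

/-- `Σ deficit = Σ_{T₃} deficit + Σ_{codeg = 0} deficit` on a `K₄⁻`-free graph. -/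
theorem sum_deficit_split (D : SimpleGraph V) [DecidableRel D.Adj] (hK : K4mFree D) :
    ∑ p ∈ adjPairsAll D, deficit D p = ∑ t ∈ triangles3 D, deficit D t.1 +
      ∑ p ∈ adjPairsAll D, (if codeg D p = 0 then deficit D p else 0) := by
  rw [sum_triangles3_fst, ← sum_add_distrib]
  apply sum_congr rfl
  intro p hp
  have h := codeg_le_one D hK hp
  rcases Nat.le_one_iff_eq_zero_or_eq_one.mp h with h0 | h1
  · rw [h0]; simp
  · rw [h1]; simp

/-- **THE ROTATED REFINED DEFICIT:** `k·|T₃| + 2·Σ_{T₃} |outer| ≤ 3·Σ_{T₃} deficit + 3·|T₃|`. -/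
theorem card_mul_add_two_mul_sum_outer_le (D : SimpleGraph V) [DecidableRel D.Adj] (hK : K4mFree D) :
    Fintype.card V * (triangles3 D).card + 2 * ∑ t ∈ triangles3 D, (outer D t.1.1 t.1.2 t.2).card ≤
      3 * ∑ t ∈ triangles3 D, deficit D t.1 + 3 * (triangles3 D).card := by
  have hrot : 3 * ∑ t ∈ triangles3 D, deficit D t.1 =
      ∑ t ∈ triangles3 D, (deficit D t.1 + deficit D (t.1.2, t.2) + deficit D (t.2, t.1.1)) := by
    rw [sum_add_distrib, sum_add_distrib, sum_triangles3_rot, sum_triangles3_rot2]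
    ring
  have key : ∀ t ∈ triangles3 D, Fintype.card V + 2 * (outer D t.1.1 t.1.2 t.2).card ≤
      (deficit D t.1 + deficit D (t.1.2, t.2) + deficit D (t.2, t.1.1)) + 3 := by
    intro t ht
    rw [mem_triangles3] at ht
    have h := deficit_triangle_outer D hK ht.1 ht.2.1 ht.2.2
    have e : deficit D t.1 = deficit D (t.1.1, t.1.2) := rfl
    omega
  have hpt := sum_le_sum key
  rw [sum_add_distrib, sum_add_distrib, sum_const, sum_const, smul_eq_mul, smul_eq_mul, ← mul_sum,
    ← hrot] at hpt
  nlinarith [hpt]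

/-- A triangle with an outer vertex contributes at least `6` to `Σ_{T₃} |outer|`. -/
theorem six_le_sum_outer (D : SimpleGraph V) [DecidableRel D.Adj] {u v w x : V} (huv : D.Adj u v)
    (huw : D.Adj u w) (hvw : D.Adj v w) (hx : x ∈ outer D u v w) :
    6 ≤ ∑ t ∈ triangles3 D, (outer D t.1.1 t.1.2 t.2).card := by
  have hx' := (mem_outer D u v w x).mp hx
  set P : Finset ((V × V) × V) :=
    {((u, v), w), ((v, w), u), ((w, u), v), ((v, u), w), ((u, w), v), ((w, v), u)} with hP
  have hsub : P ⊆ triangles3 D := by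
    intro t ht
    rw [hP] at ht
    simp only [mem_insert, mem_singleton] at ht
    rw [mem_triangles3]
    rcases ht with rfl | rfl | rfl | rfl | rfl | rfl
    · exact ⟨huv, huw, hvw⟩
    · exact ⟨hvw, huv.symm, huw.symm⟩
    · exact ⟨huw.symm, hvw.symm, huv⟩
    · exact ⟨huv.symm, hvw, huw⟩
    · exact ⟨huw, huv, hvw.symm⟩
    · exact ⟨hvw.symm, huw.symm, huv.symm⟩
  have hpos : ∀ t ∈ P, 1 ≤ (outer D t.1.1 t.1.2 t.2).card := by
    intro t ht
    rw [hP] at ht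
    simp only [mem_insert, mem_singleton] at ht
    apply card_pos.mpr
    refine ⟨x, ?_⟩
    rcases ht with rfl | rfl | rfl | rfl | rfl | rfl <;> (rw [mem_outer]; tauto)
  have hcard : P.card = 6 := by
    rw [hP, card_insert_of_notMem, card_insert_of_notMem, card_insert_of_notMem,
      card_insert_of_notMem, card_insert_of_notMem, card_singleton]
    all_goals simp [huv.ne, huw.ne, hvw.ne, huv.ne.symm, huw.ne.symm, hvw.ne.symm]
  calc 6 = ∑ _t ∈ P, 1 := by rw [sum_const, hcard]; rfl
    _ ≤ ∑ t ∈ P, (outer D t.1.1 t.1.2 t.2).card := sum_le_sum hpos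
    _ ≤ ∑ t ∈ triangles3 D, (outer D t.1.1 t.1.2 t.2).card := sum_le_sum_of_subset hsub

/-- Three triangles, the second with a vertex off the first and the third with a vertex off both, give at
least eighteen ordered triangles. -/
theorem eighteen_le_card_triangles3 (D : SimpleGraph V) [DecidableRel D.Adj]
    {u v w : V} (huv : D.Adj u v) (huw : D.Adj u w) (hvw : D.Adj v w) {a b c : V} (hab : D.Adj a b)
    (hac : D.Adj a c) (hbc : D.Adj b c) (ha : ¬ (a = u ∨ a = v ∨ a = w)) {x y z : V} (hxy : D.Adj x y)
    (hxz : D.Adj x z) (hyz : D.Adj y z) (hx : ¬ (x = u ∨ x = v ∨ x = w ∨ x = a ∨ x = b ∨ x = c)) :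
    18 ≤ (triangles3 D).card := by
  have hau : a ≠ u := fun h => ha (Or.inl h)
  have hav : a ≠ v := fun h => ha (Or.inr (Or.inl h))
  have haw : a ≠ w := fun h => ha (Or.inr (Or.inr h))
  have hxu : x ≠ u := fun h => hx (Or.inl h)
  have hxv : x ≠ v := fun h => hx (Or.inr (Or.inl h))
  have hxw : x ≠ w := fun h => hx (Or.inr (Or.inr (Or.inl h)))
  have hxa : x ≠ a := fun h => hx (Or.inr (Or.inr (Or.inr (Or.inl h))))
  have hxb : x ≠ b := fun h => hx (Or.inr (Or.inr (Or.inr (Or.inr (Or.inl h)))))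
  have hxc : x ≠ c := fun h => hx (Or.inr (Or.inr (Or.inr (Or.inr (Or.inr h)))))
  have huv' := huv.ne
  have huw' := huw.ne
  have hvw' := hvw.ne
  have hab' := hab.ne
  have hac' := hac.ne
  have hbc' := hbc.ne
  have hxy' := hxy.ne
  have hxz' := hxz.ne
  have hyz' := hyz.ne
  have hsub : ({((u, v), w), ((v, w), u), ((w, u), v), ((v, u), w), ((u, w), v), ((w, v), u),
      ((a, b), c), ((b, c), a), ((c, a), b), ((b, a), c), ((a, c), b), ((c, b), a),
      ((x, y), z), ((y, z), x), ((z, x), y), ((y, x), z), ((x, z), y), ((z, y), x)} :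
        Finset ((V × V) × V)) ⊆ triangles3 D := by
    intro t ht
    simp only [mem_insert, mem_singleton] at ht
    rw [mem_triangles3]
    rcases ht with rfl | rfl | rfl | rfl | rfl | rfl | rfl | rfl | rfl | rfl | rfl | rfl | rfl | rfl |
      rfl | rfl | rfl | rfl
    · exact ⟨huv, huw, hvw⟩
    · exact ⟨hvw, huv.symm, huw.symm⟩
    · exact ⟨huw.symm, hvw.symm, huv⟩
    · exact ⟨huv.symm, hvw, huw⟩
    · exact ⟨huw, huv, hvw.symm⟩
    · exact ⟨hvw.symm, huw.symm, huv.symm⟩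
    · exact ⟨hab, hac, hbc⟩
    · exact ⟨hbc, hab.symm, hac.symm⟩
    · exact ⟨hac.symm, hbc.symm, hab⟩
    · exact ⟨hab.symm, hbc, hac⟩
    · exact ⟨hac, hab, hbc.symm⟩
    · exact ⟨hbc.symm, hac.symm, hab.symm⟩
    · exact ⟨hxy, hxz, hyz⟩
    · exact ⟨hyz, hxy.symm, hxz.symm⟩
    · exact ⟨hxz.symm, hyz.symm, hxy⟩
    · exact ⟨hxy.symm, hyz, hxz⟩
    · exact ⟨hxz, hxy, hyz.symm⟩
    · exact ⟨hyz.symm, hxz.symm, hxy.symm⟩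
  refine le_trans ?_ (card_le_card hsub)
  rw [card_insert_of_notMem, card_insert_of_notMem, card_insert_of_notMem, card_insert_of_notMem,
    card_insert_of_notMem, card_insert_of_notMem, card_insert_of_notMem, card_insert_of_notMem,
    card_insert_of_notMem, card_insert_of_notMem, card_insert_of_notMem, card_insert_of_notMem,
    card_insert_of_notMem, card_insert_of_notMem, card_insert_of_notMem, card_insert_of_notMem,
    card_insert_of_notMem, card_singleton]
  all_goals simp [huv', huw', hvw', hab', hac', hbc', hxy', hxz', hyz', huv'.symm, huw'.symm,
    hvw'.symm, hab'.symm, hac'.symm, hbc'.symm, hxy'.symm, hxz'.symm, hyz'.symm,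
    hau.symm, hav.symm, haw.symm, hxu.symm, hxv.symm, hxw.symm, hxa.symm, hxb.symm, hxc.symm]

/-- **THE STABILITY FROM THE TRIANGLE BOUNDS (`k ≥ 8`):** with `|T₃| ≥ 12`, any of `|T₃| ≥ 18`,
`Σ_{T₃} |outer| ≥ 6`, `Σ_{codeg = 0} deficit ≥ 4` gives `Σ_v d(v)² + (k − 2) ≤ m·k`. -/
theorem stability_of_triangle_bounds (D : SimpleGraph V) [DecidableRel D.Adj] (hK : K4mFree D)
    (hk : 8 ≤ Fintype.card V) (hT : 12 ≤ (triangles3 D).card)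
    (h : 18 ≤ (triangles3 D).card ∨ 6 ≤ ∑ t ∈ triangles3 D, (outer D t.1.1 t.1.2 t.2).card ∨
      4 ≤ ∑ p ∈ adjPairsAll D, (if codeg D p = 0 then deficit D p else 0)) :
    ∑ v, deg D v * deg D v + (Fintype.card V - 2) ≤ D.edgeFinset.card * Fintype.card V := by
  have hid := two_mul_sum_deg_sq_add_sum_deficit D
  have hsplit := sum_deficit_split D hK
  have hrot := card_mul_add_two_mul_sum_outer_le D hK
  obtain ⟨j, hj⟩ := Nat.exists_eq_add_of_le hk
  rw [hj] at hrot hid ⊢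
  have e : 8 + j - 2 = j + 6 := by omega
  rw [e]
  rw [hsplit] at hid
  rw [add_mul] at hrot
  rw [mul_add] at hid ⊢
  have hjT := Nat.mul_le_mul_left j hT
  generalize hS : ∑ v, deg D v * deg D v = S at hid ⊢
  generalize hA : ∑ t ∈ triangles3 D, deficit D t.1 = A at hid hrot
  generalize hB : ∑ p ∈ adjPairsAll D, (if codeg D p = 0 then deficit D p else 0) = B at hid h
  generalize hQ : ∑ t ∈ triangles3 D, (outer D t.1.1 t.1.2 t.2).card = Q at hrot h
  generalize hTT : (triangles3 D).card = T at hid hrot hjT hT h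
  generalize hM : D.edgeFinset.card = M at hid ⊢
  rcases h with h | h | h
  · nlinarith [hid, hrot, hjT, h]
  · nlinarith [hid, hrot, hjT, hT, h]
  · nlinarith [hid, hrot, hjT, hT, h]

end C047

end TriangleCap

end PercRepro
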